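import Summits.Ventures.Crystal3D.Theorems.StickyWulffConstantCoaxialWallLawSeamFullEndUnsaturated
import HarnessLib

/-!
# A CROSS-reader (A)-end ball has at most ELEVEN contacts (E1); the common core «occupied slot star + non-moving ⇒ unsaturated»
# (crux `CoaxialWallLaw`, stmt-Ventures-19481; lane F 'Certificates' v8.3R, registered stub `stub_threePayer`, (L2) reader-type split '…SeamThreePayerSplit')

HONEST FRAMING. Venture `Summits/Ventures/Crystal3D` (cell `crystal3d-full`); sequel of '…SeamFullEndUnsaturated' (FULL readers).  CONDITIONAL on `P5Exhaustion`
(`stub_E1`).  The core of that file is isolated — **`card_contacts_le_eleven_of_star_end`**: if the closed slot star of `δ` in a frame `A` is occupied around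
`b ∈ X` and `b` is NOT moving in the class `(A, A(−δ))`, then `b` has at most eleven contacts (E1: a saturated `b` would be `A`-FULL or `A`-TWIN-READING with the
star on the own side, either of which is moving) — and applied to CROSS ends: the mover `q` twin-reads `(G, m)` with `⟪d, m⟫ = √(2/3)` and lands at
`b = q − M_m d = q − G′u` (`G′ = M_m ∘ G`, `d = G u`); the closed `G′`-star of `u` at `b` is `q` together with `q + G′(w − u)`, `⟪w, u⟫ = ½`, and these are mirror
balls or in-plane balls of `q`'s twin dozen (`⟪G′(w − u), m⟫ = ⟪G′w, m⟫ + √(2/3) ≥ 0`), all occupied; the arriving class is `(G′, b − q) = (G′, G′(−u))`.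
* `card_contacts_le_eleven_of_star_end` (core), `card_contacts_le_eleven_of_cross_end`, **`card_contacts_le_eleven_of_isEndPairA_cross`**.
With '…SeamFullEndUnsaturated': under E1 the `deg b = 12` branch of `ThreePayer` occurs only at NARROW and GLIDE ends.
WHAT THIS IS NOT: nothing about deg-11 ends; F-C1 not moved.
-/

noncomputable section

namespace Summit.Ventures.Crystal3D.Theorems

namespace TailResidue

open Summit.Ventures.Crystal3D Finset
open scoped InnerProductSpace

variable {X : Finset (EuclideanSpace ℝ (Fin 3))}

open scoped Classical in
/-- **CORE: an occupied closed slot star at a non-moving ball caps its degree at eleven** (under E1).  `X` `1`-separated, `b ∈ X`... the balls `b + A w` for all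
slots `w` with `⟪w, δ⟫ > 0` present, and `b` not moving in the class `(A, A(−δ))` (any version `v`).  Then `b` has at most eleven contacts. -/
theorem card_contacts_le_eleven_of_star_end (hE1 : P5Exhaustion) (hX : ∀ p ∈ X, ∀ p' ∈ X, p ≠ p' → 1 ≤ dist p p') {v : WordVersion}
    (A : EuclideanSpace ℝ (Fin 3) ≃ₗᵢ[ℝ] EuclideanSpace ℝ (Fin 3)) {b δ : EuclideanSpace ℝ (Fin 3)} (hδ : δ ∈ fccSlots)
    (hstar : ∀ w ∈ fccSlots, 0 < ⟪w, δ⟫_ℝ → b + A w ∈ X) (hnm : ¬ IsMoving X v A (A (-δ)) b) : (X.filter fun x => dist b x = 1).card ≤ 11 := by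
  have hle := card_filter_dist_eq_one_le_twelve X hX b
  by_contra hgt
  have h12 : (X.filter fun x => dist b x = 1).card = 12 := by omega
  set C := X.filter fun x => dist b x = 1 with hC
  have hslot_contact : ∀ {w}, w ∈ fccSlots → b + A w ∈ X → b + A w ∈ C := fun {w} hw hmem =>
    mem_filter.2 ⟨hmem, by rw [dist_eq_norm, sub_add_cancel_left, norm_neg, LinearIsometryEquiv.norm_map, norm_eq_one_of_mem_fccSlots hw]⟩
  apply hnm
  rcases shell_slots_or_twin_of_star_twelve hE1 A hX hδ hstar h12 with hall | ⟨n, hn, hown, hall⟩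
  · left
    set I := fccSlots.image fun w => b + A w with hI
    have hCI : C ⊆ I := by
      intro x hx
      obtain ⟨hxX, hxd⟩ := mem_filter.1 hx
      obtain ⟨w, hw, rfl⟩ := hall x hxX hxd
      exact mem_image.2 ⟨w, hw, rfl⟩
    have hIC : I ⊆ C := (eq_of_subset_of_card_le hCI (by rw [card_image_frame A b, h12])).symm.subset
    intro w hw
    exact (mem_filter.1 (hIC (mem_image.2 ⟨w, hw, rfl⟩))).1
  · right; left
    set D := ((fccSlots.filter fun w => ⟪A w, n⟫_ℝ ≤ 0).image fun w => b + A w) ∪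
        ((fccSlots.filter fun w => ⟪A w, n⟫_ℝ < 0).image fun w => b + (A w - (2 * ⟪A w, n⟫_ℝ) • n)) with hD
    have hCD : C ⊆ D := by
      intro x hx
      obtain ⟨hxX, hxd⟩ := mem_filter.1 hx
      exact (mem_twinDozen_iff A n b x).2 (hall x hxX hxd)
    have hDC : D ⊆ C := (eq_of_subset_of_card_le hCD (by rw [card_twinDozen A hn.1 b, h12])).symm.subset
    have hmirr : ∀ w ∈ fccSlots, ⟪A w, n⟫_ℝ < 0 → b + (A w - (2 * ⟪A w, n⟫_ℝ) • n) ∈ X := fun w hw hlt =>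
      (mem_filter.1 (hDC ((mem_twinDozen_iff A n b _).2 (Or.inr ⟨w, hw, hlt, rfl⟩)))).1
    have hfar : ∀ w ∈ fccSlots, 0 < ⟪A w, n⟫_ℝ → b + A w ∉ X := by
      intro w hw hpos hmem
      rcases hall _ hmem (mem_filter.1 (hslot_contact hw hmem)).2 with ⟨w', hw', hle', he⟩ | ⟨w', hw', hlt', he⟩
      · have : w = w' := A.injective (add_left_cancel he)
        rw [this] at hpos; linarith
      · exact slot_ne_mirror A hn hw hw' hlt' (add_left_cancel he)
    refine ⟨n, ⟨hn, hown, hmirr, hfar⟩, ?_⟩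
    have hδC : b + A δ ∈ X := hstar δ hδ (by rw [real_inner_self_eq_norm_sq, norm_eq_one_of_mem_fccSlots hδ]; norm_num)
    have hown_δ : ⟪A δ, n⟫_ℝ ≤ 0 := by
      rcases hall _ hδC (mem_filter.1 (hslot_contact hδ hδC)).2 with ⟨w', hw', hle', he⟩ | ⟨w', hw', hlt', he⟩
      · have : δ = w' := A.injective (add_left_cancel he)
        rw [this]; exact hle'
      · exact absurd (add_left_cancel he) (slot_ne_mirror A hn hδ hw' hlt')
    rw [map_neg, inner_neg_left]
    rcases hn.2 δ hδ with e | e | e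
    · exact Or.inr (by rw [e, neg_zero])
    · rw [e] at hown_δ
      have : (0 : ℝ) < Real.sqrt (2 / 3) := Real.sqrt_pos.2 (by norm_num)
      linarith
    · exact Or.inl (by rw [e, neg_neg])

open scoped Classical in
/-- **A CROSS-READER END BALL HAS AT MOST ELEVEN CONTACTS** (under E1).  `q ∈ X` twin-reads `(G, m)`, `u` a slot with `⟪G u, m⟫ = √(2/3)`, and the target
`b = q − (G u − 2⟪G u, m⟫ m)` is not moving in the mirrored class `(G ∘ M_m, b − q)`. -/
theorem card_contacts_le_eleven_of_cross_end (hE1 : P5Exhaustion) (hX : ∀ p ∈ X, ∀ p' ∈ X, p ≠ p' → 1 ≤ dist p p') {v : WordVersion}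
    (G : EuclideanSpace ℝ (Fin 3) ≃ₗᵢ[ℝ] EuclideanSpace ℝ (Fin 3)) {b q u m : EuclideanSpace ℝ (Fin 3)} (hq : q ∈ X) (hu : u ∈ fccSlots)
    (htw : IsTwinReading X G m q) (hdm : ⟪G u, m⟫_ℝ = Real.sqrt (2 / 3)) (hbq : b = q - (G u - (2 * ⟪G u, m⟫_ℝ) • m))
    (hnm : ¬ IsMoving X v (G.trans (ℝ ∙ m)ᗮ.reflection) (b - q) b) : (X.filter fun x => dist b x = 1).card ≤ 11 := by
  set G' := G.trans (ℝ ∙ m)ᗮ.reflection with hG'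
  have hm1 : ‖m‖ = 1 := htw.1.1
  have hmm : ⟪m, m⟫_ℝ = 1 := by rw [real_inner_self_eq_norm_sq, hm1, one_pow]
  have hG'app : ∀ w, G' w = G w - (2 * ⟪G w, m⟫_ℝ) • m := fun w => by rw [hG']; exact reflection_unit_apply hm1 (G w)
  have hG'm : ∀ w, ⟪G' w, m⟫_ℝ = -⟪G w, m⟫_ℝ := fun w => by
    rw [hG'app, inner_sub_left, inner_smul_left, hmm]; simp; ring
  have hbq' : b = q - G' u := by rw [hbq, hG'app]
  have hdir : b - q = G' (-u) := by rw [hbq', map_neg]; abel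
  rw [hdir] at hnm
  -- the closed `G'`-star of `u` at `b` is occupied
  have hstar : ∀ w ∈ fccSlots, 0 < ⟪w, u⟫_ℝ → b + G' w ∈ X := by
    intro w hw hpos
    rcases eq_or_inner_eq_half_of_inner_pos hw hu hpos with h | h
    · rw [h, hbq', sub_add_cancel]; exact hq
    · have hc : w - u ∈ fccSlots := sub_mem_fccSlots_of_inner_eq_half hw hu h
      have e : b + G' w = q + G' (w - u) := by rw [hbq', map_sub]; abel
      rw [e]
      -- `⟪G'(w − u), m⟫ = ⟪G' w, m⟫ + √(2/3) ≥ 0`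
      have hge : 0 ≤ ⟪G' (w - u), m⟫_ℝ := by
        rw [map_sub, inner_sub_left, hG'm, hG'm, hdm]
        have hpos23 : (0 : ℝ) ≤ Real.sqrt (2 / 3) := Real.sqrt_nonneg _
        rcases htw.1.2 w hw with e' | e' | e' <;> rw [e'] <;> linarith
      rcases eq_or_lt_of_le hge with h0 | hpos'
      · -- in-plane: `G'(w − u) = G(w − u)` and the own side is occupied
        have h0' : ⟪G (w - u), m⟫_ℝ = 0 := by have := hG'm (w - u); linarith
        have e2 : G' (w - u) = G (w - u) := by rw [hG'app, h0']; simp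
        rw [e2]; exact htw.2.1 _ hc h0'.le
      · -- positive for `G'` = negative for `G`: a mirror ball of the twin reading
        have hneg : ⟪G (w - u), m⟫_ℝ < 0 := by have := hG'm (w - u); linarith
        rw [hG'app]; exact htw.2.2.1 _ hc hneg
  exact card_contacts_le_eleven_of_star_end hE1 hX G' hu hstar (by rwa [map_neg] at hnm ⊢)

open scoped Classical in
/-- **The CROSS branch of `IsEndPairA` has `deg b ≤ 11`** (under E1; slot-rooted systems). -/
theorem card_contacts_le_eleven_of_isEndPairA_cross (hE1 : P5Exhaustion) (hX : ∀ p ∈ X, ∀ p' ∈ X, p ≠ p' → 1 ≤ dist p p') {v : WordVersion}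
    {S₁ S₂ : PlateSystem} (h₁ : S₁.RT ⊆ fccSlots) (h₂ : S₂.RT ⊆ fccSlots) {b q : EuclideanSpace ℝ (Fin 3)}
    {G : EuclideanSpace ℝ (Fin 3) ≃ₗᵢ[ℝ] EuclideanSpace ℝ (Fin 3)} {d : EuclideanSpace ℝ (Fin 3)} (hq : q ∈ X) (hadm : S₁.Adm G d ∨ S₂.Adm G d)
    (hcross : ∃ m, IsTwinReading X G m q ∧ ⟪d, m⟫_ℝ = Real.sqrt (2 / 3) ∧ b = q - (d - (2 * ⟪d, m⟫_ℝ) • m) ∧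
      ¬ IsMoving X v (G.trans (ℝ ∙ m)ᗮ.reflection) (b - q) b) : (X.filter fun x => dist b x = 1).card ≤ 11 := by
  obtain ⟨u, hu, hdu⟩ : ∃ w ∈ fccSlots, d = G w := by
    rcases hadm with h | h
    · exact (exists_slots_of_adm h₁ h).1
    · exact (exists_slots_of_adm h₂ h).1
  subst hdu
  obtain ⟨m, htw, hdm, hbq, hnm⟩ := hcross
  exact card_contacts_le_eleven_of_cross_end hE1 hX G hq hu htw hdm hbq hnm

end TailResidue

end Summit.Ventures.Crystal3D.Theorems

end
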